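import Summits.QuantumFields.BalabanUV.Beta.FP.TowerFWindingRow
import Summits.QuantumFields.BalabanUV.Beta.FP.TowerFTransportRowW
import Summits.QuantumFields.BalabanUV.Beta.FP.TowerFAnchorRowW

/-!
# `BalabanUV.Beta.FP.TowerFWindingRowW` — road «FP», binder row D1, ROUTE T, the (H5-F) option (3a) (road A-4, journal [D1P3-G62-A4]; an2 g85 W-3 (a), W-5 (3)):
# **THE END's F-WINDING LETTER `hWFw` FOR ANY EXPONENTIALLY LOCALISED STEP WEIGHT FAMILY** — road g59 `TowerFWindingRow` §2–§3 with `wStep Lc (n+1) ↦ w n`, `wStep Lc 1 ↦ w 0`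
# (generator ×13), `abs_wStep_le ↦ hwloc` (×2), `exists_vertexFamilies_FRec[_zero] ↦ …_w` (g61 `TowerFTransportRowW ∕ TowerFAnchorRowW`), names `… ↦ …_w`; §1's generic letters
# (`dressW_swap`, `trK_scaleK_of_trK_eq_sgnK`, `winding_letter_evenWound_of_swap`) and `WGlit_swap` imported BY NAME

WHY (journal an2 g85 W-3 (a) ∕ W-5 (3)).  Under (3a) the END's second-order F-family is dressed by the renormalised true weight `w n := fun c μ p => (α n)⁻¹ * wF Lc Q ℓ sn n c μ p`
(an2 PART 96∕97; `hwloc` = PART 97 v1.3 `hwloc_mul_wF`).  v10's winding binder `hWFw` (the periodised tadpole traces of the wound family and of the raw member against the F-leg differ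
by a null sequence) is discharged at the record by g59's `hWFw_rec ∕ hWFw_zero` — AT `wStep`, whose only property used is its exponential localisation `abs_wStep_le` (through
`dressW_swap` and the family letters).  THIS FILE repeats the two letters and their swap lemmas at a generic `w` displayed with ONE letter `hwloc` (the shape of `abs_wStep_le`,
= `TowerFTransportRowW`'s).

WHAT ([folklore] BY NAME; no `def`, no `def … : Prop`, nothing cited, 0 sorry): §1 `FRecW_swap_w`, **`hWFw_rec_w`**; §2 `FZeroW_swap_w`, **`hWFw_zero_w`** — v10's binder texts under
σ = {`(𝒲F (n+1))` ↦ `scaleK σ′ σ′ (Lc⁸ • dressW (Lc^(n+1)) Lc (w n) (WN ctr Pn n))`, `(𝒲bF (n+1)) B` ↦ its wound even half; storey 1: the literal's pair dressed by `w 0`}.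
WHAT THIS IS NOT: not the weight (PART 96) nor `hwloc` (PART 97); nothing of Bałaban's asserted, valued or discharged; 0 estimates; 0∕4 row-D1 binders (hW, hR, D1Tel, D1Rep); NOT (C1),
NOT (T-ID), NOT D1, NEVER «G-an2-4 closed», NOT BetaPertH, NOT continuum, NOT Clay.

HONEST DEPENDENCY (page 1, mandatory): continuum YM on T⁴ ⇐ BetaPertH ∧ nine spine estimates (0/9 proved); BetaPertH ⇐ (D1) ∧ (D4) ∧ CAP+tail;
G-an2-4 gates asym, D1 and NE2/3/4.  HONEST FRAMING (cell contract, verbatim): «discharging `BetaPertH` makes Bałaban's UV stability UNCONDITIONAL —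
a real constructive-QFT result; it is NOT the continuum limit and NOT the Clay problem.»  ABSOLUTE RULE (cell charter, verbatim): «No internally-minted
statement may enter as a cited fact. Every hypothesis is either kernel-proved in this package or a verbatim quotation of a PUBLISHED theorem with page
reference. The manuscript(s) under audit are NOT citable for their own disputed steps — they are the thing under adjudication; programme-internal
(2001/route/tribunal) claims are never citable.»  Road «FP» OWNER, b2b-balaban-beta-d1-p3 gen 62, 2026-08-30.  No existing file touched.
-/

noncomputable section

open scoped BigOperators Matrix Topology
open Finset Filter

namespace Summit.QuantumFields.BalabanUV.Beta.FP.TowerFWindingRowW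

open Literature.MathematicalPhysics.QuantumFieldTheory
open Literature.MathematicalPhysics.QuantumFieldTheory.Balaban1983to89
open Literature.MathematicalPhysics.QuantumFieldTheory.Balaban1983to89.Beta
open B12Sec2to5 (l1 l1_nonneg)
open B4TorusKernel.MultiPeriod (translate)
open B5Prop11Plancherel (fine)
open ExpKernelCalculus (Site MKer Decays BiLoc VertexFamily₂ tadpole)
open DressedMomentNormalisation (EKer)
open HessKerRate (scaleK scaleK_apply)
open HessianTelescopingKKT (wStep)
open OneStepResolventKernel (Fib)
open KernelWard (ProdBound tsum_comm_of_prodBound)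
open Summit.QuantumFields.BalabanUV.Beta.TameKernelCalculus (trK trK_apply Spr)
open Summit.QuantumFields.BalabanUV.Beta.BorderedHessian (sgnK sgnK_apply)
open Summit.QuantumFields.BalabanUV.Beta.SymSecondOrderTablesAn1 (symTablesAn1S2)
open Summit.QuantumFields.BalabanUV.Beta.CompositeOneShotJetData (Roots Pins AN WN)
open Summit.QuantumFields.BalabanUV.Beta.CombChartStepJets (GcombSh JsB12CombSh0 JsB12CombSh0_eq JsComb0Of_W)
open Summit.QuantumFields.BalabanUV.Beta.ChartStepJets (WchartOf_eq WchartOf_GcombSh)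
open Summit.QuantumFields.BalabanUV.Beta.SpineRooted (WrecOf_swap)
open Summit.QuantumFields.BalabanUV.Beta.CombChartWardSockets (trK_GcombSh)
open Summit.QuantumFields.BalabanUV.Beta.NVertexParities (vertexFamilies_VN_WN)
open Summit.QuantumFields.BalabanUV.Beta.FP.CompositeOneShotChartParity (trK_AN)
open Summit.QuantumFields.BalabanUV.Beta.FP.TowerNParityRowsEven (WN_swap)
open Summit.QuantumFields.BalabanUV.Beta.FP.KernelPeriodisationFib (perF translate_invariant_of_shiftK)
open Summit.QuantumFields.BalabanUV.Beta.FP.KernelPeriodisationFibLoc (dper)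
open Summit.QuantumFields.BalabanUV.Beta.FP.KernelPeriodisationFibHessKer (tendsto_trace_tadpole')
open Summit.QuantumFields.BalabanUV.Beta.FP.KernelPeriodisationFibWoundLetter (tendsto_trace_tadpole_evenHalf_of_swap)
open Summit.QuantumFields.BalabanUV.Beta.FP.SecondOrderTableEvenPart (tadpole_evenHalf loc_of_biLoc)
open Summit.QuantumFields.BalabanUV.Beta.FP.TorusCompositeObjects (towerTorus towerTorus_apply)
open Summit.QuantumFields.BalabanUV.Beta.FP.KernelStepDressing (dressW dressW_apply)
open Summit.QuantumFields.BalabanUV.Beta.FP.KernelStepDressingHessKer (abs_col_le)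
open Summit.QuantumFields.BalabanUV.Beta.D1BFx.DressedBubbleBridge (summable_abs_of_expWeight)
open Summit.QuantumFields.BalabanUV.Beta.FP.TowerFChartLetters (hAFsh_rec exists_decays_AF_rec)
open Summit.QuantumFields.BalabanUV.Beta.FP.TowerFTransportRow (abs_wStep_le exists_vertexFamilies_FRec)
open Summit.QuantumFields.BalabanUV.Beta.FP.TowerFAnchorRow (hAFsh_zero exists_decays_AF_zero exists_vertexFamilies_FRec_zero)
open Summit.QuantumFields.BalabanUV.Beta.FP.TowerFWindingRow (dressW_swap trK_scaleK_of_trK_eq_sgnK winding_letter_evenWound_of_swap WGlit_swap)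
open Summit.QuantumFields.BalabanUV.Beta.FP.TowerFTransportRowW (exists_vertexFamilies_FRec_w)
open Summit.QuantumFields.BalabanUV.Beta.FP.TowerFAnchorRowW (exists_vertexFamilies_FRec_zero_w)

/-! ## §1 THE WINDING LETTER AT THE RECORD FOR ANY STEP WEIGHT FAMILY, storeys `k+2`: v10's `hWFw` (L.252) under skeleton N's σ -/

section Record

variable (Lc : ℕ) [NeZero Lc] (Pn : Pins) (uF : ℕ → ℝ) (w : ℕ → EKer (3 + 1))
  (hwloc : ∀ j : ℕ, ∃ δ C : ℝ, 0 < δ ∧ 0 ≤ C ∧ ∀ (κ l : Fin (3 + 1)) (p : Fin (3 + 1) → ℤ), |w j κ l p| ≤ C * Real.exp (-δ * l1 p))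
include hwloc

/-- [folklore] **the END's σ′-scaled dressed second-order family is swap-symmetric** (an2 `WN_swap` through §1 `dressW_swap` at `hwloc n` and an2's
`vertexFamilies_VN_WN`; the units and `Lc⁸` act on the value). -/
theorem FRecW_swap_w (n : ℕ) (μ : Fin (3 + 1)) (y : Site (3 + 1)) (ν : Fin (3 + 1)) (y' : Site (3 + 1)) :
    (fun μ y ν y' => scaleK (Sum.elim (fun _ : Fin (3 + 1) => (1 : ℝ)) (fun _ : Fin (3 + 1) => (uF n))) (Sum.elim (fun _ : Fin (3 + 1) => (1 : ℝ)) (fun _ : Fin (3 + 1) => (uF n))) ((Lc : ℝ) ^ 8 • dressW (Lc ^ (n + 1)) Lc (w n) (WN (Roots.ctr Lc) Pn n) μ y ν y')) ν y' μ y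
      = (fun μ y ν y' => scaleK (Sum.elim (fun _ : Fin (3 + 1) => (1 : ℝ)) (fun _ : Fin (3 + 1) => (uF n))) (Sum.elim (fun _ : Fin (3 + 1) => (1 : ℝ)) (fun _ : Fin (3 + 1) => (uF n))) ((Lc : ℝ) ^ 8 • dressW (Lc ^ (n + 1)) Lc (w n) (WN (Roots.ctr Lc) Pn n) μ y ν y')) μ y ν y' := by
  obtain ⟨δw, Cw0, hδw, -, hw⟩ := hwloc n
  obtain ⟨Cv, Cw, δ, hδ, -, hW⟩ := vertexFamilies_VN_WN (Roots.ctr Lc) Pn n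
  show scaleK _ _ ((Lc : ℝ) ^ 8 • dressW (Lc ^ (n + 1)) Lc (w n) (WN (Roots.ctr Lc) Pn n) ν y' μ y) = _
  rw [dressW_swap (N := Lc ^ (n + 1)) Lc (fun c a u => hw c a u) hδw hW hδ.le (WN_swap (Roots.ctr Lc) Pn n) μ y ν y']

variable (huF : ∀ j, 1 ≤ uF j) (Mc : ℕ → (Fin (3 + 1) → ℕ)) [∀ B μ, NeZero (Mc B μ)] (hMc : ∀ K : ℕ, ∀ᶠ B in atTop, ∀ i, K ≤ Mc B i)
include huF hMc

/-- [folklore] **`hWFw` AT THE RECORD, storeys `k+2`** — v10 `StepRecursionFeedNestedNamedI.d1Tel_JcComp_ctr_namedI`'s binder `hWFw` (L.252) CHARACTER FOR CHARACTER under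
σ = {`(AF (n + 1))` ↦ `(scaleK (Sum.elim 1 (uF n)⁻¹) (Sum.elim 1 (uF n)⁻¹) (AN (Roots.ctr Lc) n))`, `(𝒲F (n + 1))` ↦ the σ′-scaled `Lc⁸ • dressW (Lc ^ (n + 1)) Lc (w n) (WN (Roots.ctr Lc) Pn n)`,
`(𝒲bF (n + 1)) B` ↦ its source-wound even half on `Mc B`}: §1 `winding_letter_evenWound_of_swap` on the torus `towerTorus Lc (fine Lc (Mc B)) (n + 1) = Lc^(n+1)·(Lc·Mc B)` fed the
chart's letters (`exists_decays_AF_rec`, `hAFsh_rec` → `translate_invariant_of_shiftK`, `trK_AN` → `trK_scaleK_of_trK_eq_sgnK`) and the family's (`exists_vertexFamilies_FRec_w`, `FRecW_swap_w`). -/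
theorem hWFw_rec_w (n : ℕ) (μ ν : Fin (3 + 1)) (z : Fin (3 + 1) → ℤ) : Tendsto (fun B : ℕ => Matrix.trace (perF (towerTorus Lc (fine Lc (Mc B)) (n + 1)) (scaleK (Sum.elim (fun _ : Fin (3 + 1) => (1 : ℝ)) (fun _ : Fin (3 + 1) => (uF n)⁻¹)) (Sum.elim (fun _ : Fin (3 + 1) => (1 : ℝ)) (fun _ : Fin (3 + 1) => (uF n)⁻¹)) (AN (Roots.ctr Lc) n)) * perF (towerTorus Lc (fine Lc (Mc B)) (n + 1)) (dper (towerTorus Lc (fine Lc (Mc B)) (n + 1)) ((fun μ y ν y' => (fun x z a b => ∑' e : Site (3 + 1), ((1 / 2 : ℝ) • ((fun μ y ν y' => scaleK (Sum.elim (fun _ : Fin (3 + 1) => (1 : ℝ)) (fun _ : Fin (3 + 1) => (uF n))) (Sum.elim (fun _ : Fin (3 + 1) => (1 : ℝ)) (fun _ : Fin (3 + 1) => (uF n))) ((Lc : ℝ) ^ 8 • dressW (Lc ^ (n + 1)) Lc (w n) (WN (Roots.ctr Lc) Pn n) μ y ν y')) μ y ν (translate (Mc B) y' e) + sgnK (trK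 ((fun μ y ν y' => scaleK (Sum.elim (fun _ : Fin (3 + 1) => (1 : ℝ)) (fun _ : Fin (3 + 1) => (uF n))) (Sum.elim (fun _ : Fin (3 + 1) => (1 : ℝ)) (fun _ : Fin (3 + 1) => (uF n))) ((Lc : ℝ) ^ 8 • dressW (Lc ^ (n + 1)) Lc (w n) (WN (Roots.ctr Lc) Pn n) μ y ν y')) μ y ν (translate (Mc B) y' e))))) x z a b)) μ 0 ν z))) - Matrix.trace (perF (towerTorus Lc (fine Lc (Mc B)) (n + 1)) (scaleK (Sum.elim (fun _ : Fin (3 + 1) => (1 : ℝ)) (fun _ : Fin (3 + 1) => (uF n)⁻¹)) (Sum.elim (fun _ : Fin (3 + 1) => (1 : ℝ)) (fun _ : Fin (3 + 1) => (uF n)⁻¹)) (AN (Roots.ctr Lc) n)) * perF (towerTorus Lc (fine Lc (Mc B)) (n + 1)) (dper (towerTorus Lc (fine Lc (Mc B)) (n + 1)) ((fun μ y ν y' => scaleK (Sum.elim (fun _ : Fin (3 + 1) => (1 : ℝ)) (fun _ : Fin (3 + 1) => (uF n))) (Sum.elim (fun _ : Fin (3 + 1) => (1 : ℝ)) (fun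 _ : Fin (3 + 1) => (uF n))) ((Lc : ℝ) ^ 8 • dressW (Lc ^ (n + 1)) Lc (w n) (WN (Roots.ctr Lc) Pn n) μ y ν y')) μ 0 ν z)))) atTop (𝓝 0) := by
  have hL0 : 0 < Lc := Nat.pos_of_ne_zero (NeZero.ne Lc)
  obtain ⟨αF, CAF, hαF, -, hAF⟩ := exists_decays_AF_rec Lc uF n
  obtain ⟨CvF, CwF, δF, hδF, -, hWF⟩ := exists_vertexFamilies_FRec_w Lc Pn uF w hwloc huF n
  have hT : ∀ K : ℕ, ∀ᶠ B in atTop, ∀ i, K ≤ towerTorus Lc (fine Lc (Mc B)) (n + 1) i :=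
    fun K => (hMc K).mono fun B hB i => le_trans (hB i) (by
      rw [towerTorus_apply]
      exact le_trans (Nat.le_mul_of_pos_left _ hL0) (Nat.le_mul_of_pos_left _ (pow_pos hL0 _)))
  have hAinv : ∀ (B : ℕ) (m x y : Fin (3 + 1) → ℤ) (a b : Fib 3),
      scaleK (Sum.elim (fun _ : Fin (3 + 1) => (1 : ℝ)) (fun _ : Fin (3 + 1) => (uF n)⁻¹)) (Sum.elim (fun _ : Fin (3 + 1) => (1 : ℝ)) (fun _ : Fin (3 + 1) => (uF n)⁻¹)) (AN (Roots.ctr Lc) n)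
          (translate (towerTorus Lc (fine Lc (Mc B)) (n + 1)) x m) (translate (towerTorus Lc (fine Lc (Mc B)) (n + 1)) y m) a b
        = scaleK (Sum.elim (fun _ : Fin (3 + 1) => (1 : ℝ)) (fun _ : Fin (3 + 1) => (uF n)⁻¹)) (Sum.elim (fun _ : Fin (3 + 1) => (1 : ℝ)) (fun _ : Fin (3 + 1) => (uF n)⁻¹)) (AN (Roots.ctr Lc) n) x y a b :=
    fun B m x y a b => translate_invariant_of_shiftK (towerTorus Lc (fine Lc (Mc B)) (n + 1)) (hAFsh_rec Lc uF n)
      (fun i => ⟨Lc * Mc B i, by rw [towerTorus_apply]⟩) m x y a b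
  exact winding_letter_evenWound_of_swap (fun B => towerTorus Lc (fine Lc (Mc B)) (n + 1)) Mc hT hMc hAF hαF
    (trK_scaleK_of_trK_eq_sgnK _ (trK_AN (Roots.ctr Lc) n)) hAinv (FRecW_swap_w Lc Pn uF w hwloc n) hWF hδF μ 0 ν z

end Record

/-! ## §2 THE WINDING LETTER AT THE RECORD FOR ANY STEP WEIGHT FAMILY, storey `1` (the dressed LITERAL): v10's `hWFw` at `n := 0` under skeleton N's σ -/

section Zero

variable (Lc : ℕ) [NeZero Lc] (hLc : Odd Lc) (N : ℕ) (cΛ cB : ℝ) (uF : ℕ → ℝ) (w : ℕ → EKer (3 + 1))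
  (hwloc : ∀ j : ℕ, ∃ δ C : ℝ, 0 < δ ∧ 0 ≤ C ∧ ∀ (κ l : Fin (3 + 1)) (p : Fin (3 + 1) → ℤ), |w j κ l p| ≤ C * Real.exp (-δ * l1 p))

include hwloc in
/-- [folklore] **the END's σ′₀-scaled dressed literal family is swap-symmetric** (`WGlit_swap 0` through §1 `dressW_swap` at `hwloc 0` and the jet record's own `loc₂`). -/
theorem FZeroW_swap_w (μ : Fin (3 + 1)) (y : Site (3 + 1)) (ν : Fin (3 + 1)) (y' : Site (3 + 1)) :
    (fun μ y ν y' => scaleK (Sum.elim (fun _ : Fin (3 + 1) => (1 : ℝ)) (fun _ : Fin (3 + 1) => (uF 0))) (Sum.elim (fun _ : Fin (3 + 1) => (1 : ℝ)) (fun _ : Fin (3 + 1) => (uF 0))) ((Lc : ℝ) ^ 8 • dressW Lc Lc (w 0) (JsB12CombSh0 hLc N (symTablesAn1S2 3 Lc cΛ) cΛ cB 0).W μ y ν y')) ν y' μ y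
      = (fun μ y ν y' => scaleK (Sum.elim (fun _ : Fin (3 + 1) => (1 : ℝ)) (fun _ : Fin (3 + 1) => (uF 0))) (Sum.elim (fun _ : Fin (3 + 1) => (1 : ℝ)) (fun _ : Fin (3 + 1) => (uF 0))) ((Lc : ℝ) ^ 8 • dressW Lc Lc (w 0) (JsB12CombSh0 hLc N (symTablesAn1S2 3 Lc cΛ) cΛ cB 0).W μ y ν y')) μ y ν y' := by
  obtain ⟨δw, Cw0, hδw, -, hw⟩ := hwloc 0
  set J := JsB12CombSh0 hLc N (symTablesAn1S2 3 Lc cΛ) cΛ cB 0 with hJ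
  show scaleK _ _ ((Lc : ℝ) ^ 8 • dressW Lc Lc (w 0) J.W ν y' μ y) = _
  rw [dressW_swap (N := Lc) Lc (fun c a u => hw c a u) hδw J.loc₂ J.δ_pos.le (WGlit_swap Lc hLc N cΛ cB 0) μ y ν y']

variable (huF : 1 ≤ uF 0) (Mc : ℕ → (Fin (3 + 1) → ℕ)) [∀ B μ, NeZero (Mc B μ)] (hMc : ∀ K : ℕ, ∀ᶠ B in atTop, ∀ i, K ≤ Mc B i)
include huF hMc

include hwloc in
/-- [folklore] **`hWFw` AT THE RECORD, storey `1`** — v10's binder `hWFw` (L.252) at `n := 0` CHARACTER FOR CHARACTER under σ = {`(AF (n + 1))` ↦ `(scaleK σ₀⁻ σ₀⁻ (GcombSh Lc 0))`,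
`(𝒲F (n + 1))` ↦ the σ′₀-scaled `Lc⁸ • dressW Lc Lc (w 0) (JsB12CombSh0 … 0).W`, `(𝒲bF (n + 1)) B` ↦ its source-wound even half on `Mc B`, `(n + 1)` ↦ `(0 + 1)`}: §1 on the torus
`towerTorus Lc (fine Lc (Mc B)) (0 + 1)` fed `exists_decays_AF_zero`, `hAFsh_zero` → `translate_invariant_of_shiftK`, `trK_GcombSh` → `trK_scaleK_of_trK_eq_sgnK`,
`exists_vertexFamilies_FRec_zero_w`, `FZeroW_swap_w`. -/
theorem hWFw_zero_w (μ ν : Fin (3 + 1)) (z : Fin (3 + 1) → ℤ) : Tendsto (fun B : ℕ => Matrix.trace (perF (towerTorus Lc (fine Lc (Mc B)) (0 + 1)) (scaleK (Sum.elim (fun _ : Fin (3 + 1) => (1 : ℝ)) (fun _ : Fin (3 + 1) => (uF 0)⁻¹)) (Sum.elim (fun _ : Fin (3 + 1) => (1 : ℝ)) (fun _ : Fin (3 + 1) => (uF 0)⁻¹)) (GcombSh (d := 3) Lc 0)) * perF (towerTorus Lc (fine Lc (Mc B)) (0 + 1)) (dper (towerTorus Lc (fine Lc (Mc B)) (0 +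 1)) ((fun μ y ν y' => (fun x z a b => ∑' e : Site (3 + 1), ((1 / 2 : ℝ) • ((fun μ y ν y' => scaleK (Sum.elim (fun _ : Fin (3 + 1) => (1 : ℝ)) (fun _ : Fin (3 + 1) => (uF 0))) (Sum.elim (fun _ : Fin (3 + 1) => (1 : ℝ)) (fun _ : Fin (3 + 1) => (uF 0))) ((Lc : ℝ) ^ 8 • dressW Lc Lc (w 0) (JsB12CombSh0 hLc N (symTablesAn1S2 3 Lc cΛ) cΛ cB 0).W μ y ν y')) μ y ν (translate (Mc B) y' e) + sgnK (trK ((fun μ y ν y' => scaleK (Sum.elim (fun _ : Fin (3 + 1) => (1 : ℝ)) (fun _ : Fin (3 + 1) => (uF 0))) (Sum.elim (fun _ : Fin (3 + 1) => (1 : ℝ)) (fun _ : Fin (3 + 1) => (uF 0))) ((Lc : ℝ) ^ 8 • dressW Lc Lc (w 0) (JsB12CombSh0 hLc N (symTablesAn1S2 3 Lc cΛ) cΛ cB 0).W μ y ν y')) μ y ν (translate (Mc B) y' e))))) x z a b)) μ 0 ν z))) - Matrix.trace (perF (towerTorus Lc (fine Lc (Mc B)) (0 + 1)) (scaleK (Sum.elim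 (fun _ : Fin (3 + 1) => (1 : ℝ)) (fun _ : Fin (3 + 1) => (uF 0)⁻¹)) (Sum.elim (fun _ : Fin (3 + 1) => (1 : ℝ)) (fun _ : Fin (3 + 1) => (uF 0)⁻¹)) (GcombSh (d := 3) Lc 0)) * perF (towerTorus Lc (fine Lc (Mc B)) (0 + 1)) (dper (towerTorus Lc (fine Lc (Mc B)) (0 + 1)) ((fun μ y ν y' => scaleK (Sum.elim (fun _ : Fin (3 + 1) => (1 : ℝ)) (fun _ : Fin (3 + 1) => (uF 0))) (Sum.elim (fun _ : Fin (3 + 1) => (1 : ℝ)) (fun _ : Fin (3 + 1) => (uF 0))) ((Lc : ℝ) ^ 8 • dressW Lc Lc (w 0) (JsB12CombSh0 hLc N (symTablesAn1S2 3 Lc cΛ) cΛ cB 0).W μ y ν y')) μ 0 ν z)))) atTop (𝓝 0) := by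
  have hL0 : 0 < Lc := Nat.pos_of_ne_zero (NeZero.ne Lc)
  obtain ⟨αF, CAF, hαF, -, hAF⟩ := exists_decays_AF_zero Lc uF
  obtain ⟨CvF, CwF, δF, hδF, -, hWF⟩ := exists_vertexFamilies_FRec_zero_w Lc hLc N cΛ cB uF w hwloc huF
  have hT : ∀ K : ℕ, ∀ᶠ B in atTop, ∀ i, K ≤ towerTorus Lc (fine Lc (Mc B)) (0 + 1) i :=
    fun K => (hMc K).mono fun B hB i => le_trans (hB i) (by
      rw [towerTorus_apply]
      exact le_trans (Nat.le_mul_of_pos_left _ hL0) (Nat.le_mul_of_pos_left _ (pow_pos hL0 _)))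
  have hAinv : ∀ (B : ℕ) (m x y : Fin (3 + 1) → ℤ) (a b : Fib 3),
      scaleK (Sum.elim (fun _ : Fin (3 + 1) => (1 : ℝ)) (fun _ : Fin (3 + 1) => (uF 0)⁻¹)) (Sum.elim (fun _ : Fin (3 + 1) => (1 : ℝ)) (fun _ : Fin (3 + 1) => (uF 0)⁻¹)) (GcombSh (d := 3) Lc 0)
          (translate (towerTorus Lc (fine Lc (Mc B)) (0 + 1)) x m) (translate (towerTorus Lc (fine Lc (Mc B)) (0 + 1)) y m) a b
        = scaleK (Sum.elim (fun _ : Fin (3 + 1) => (1 : ℝ)) (fun _ : Fin (3 + 1) => (uF 0)⁻¹)) (Sum.elim (fun _ : Fin (3 + 1) => (1 : ℝ)) (fun _ : Fin (3 + 1) => (uF 0)⁻¹)) (GcombSh (d := 3) Lc 0) x y a b :=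
    fun B m x y a b => translate_invariant_of_shiftK (towerTorus Lc (fine Lc (Mc B)) (0 + 1)) (hAFsh_zero Lc uF)
      (fun i => ⟨Lc * Mc B i, by rw [towerTorus_apply]⟩) m x y a b
  exact winding_letter_evenWound_of_swap (fun B => towerTorus Lc (fine Lc (Mc B)) (0 + 1)) Mc hT hMc hAF hαF
    (trK_scaleK_of_trK_eq_sgnK _ (trK_GcombSh (d := 3) (Lc := Lc) 0)) hAinv (FZeroW_swap_w Lc hLc N cΛ cB uF w hwloc) hWF hδF μ 0 ν z

end Zero

end Summit.QuantumFields.BalabanUV.Beta.FP.TowerFWindingRowW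

end
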